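import Summits.NavierStokesRegularity.NavierStokesRegularity.Theorems.UnthreadedDoorIndicatrixJointRadialGauge
import Summits.NavierStokesRegularity.NavierStokesRegularity.Theorems.UnthreadedDoorNetFluxCurledLawRadialGauge
import Summits.NavierStokesRegularity.NavierStokesRegularity.Theorems.UnthreadedDoorCellFluxGlue
import Summits.NavierStokesRegularity.NavierStokesRegularity.Theorems.UnthreadedDoorCellFluxGaugeRigidity
import Summits.NavierStokesRegularity.NavierStokesRegularity.Theorems.UnthreadedDoorCellFluxZonalVorticityVanishes
import HarnessLib

/-!
# Route `UnthreadedDoor`, crux `PoloidalLiouville` (stmt-NavierStokesRegularity-1222), WALL W1 — crux idea «indicatrix-bound» (ns-idea-14):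
# Λ-5 `AnalyticDataTypeIScalarLiouville → AnalyticFrameTypeIScalarLiouville` (the radial gauge), and K3^ω ⟹ the Type-I half of W1 BY NAME

Support file (theorems only; `--supports stmt-NavierStokesRegularity-1222 --as helper`).  The registered stub Λ-5 of
`Cruxes/PoloidalLiouville/IndicatrixSketch.lean` (v1.7.5 l.861), `stub_analyticFrame_of_analyticData : AnalyticDataTypeIScalarLiouville →
AnalyticFrameTypeIScalarLiouville` (= the analytic branch of the cell-flux card's Σ-5): given Type-I scalar Liouville for JOINTLY real-analytic unthreaded data
`(v, T)` (K3^ω), deduce it for data whose velocity alone is jointly analytic in the given frame.  Proof (the custodian's recipe): re-gauge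
`T̃ t x := T t x − T t (x₀ + ‖x − x₀‖ • σ₀)`; `T̃` is smooth off the centre line, bounded (`2C`), has the same sphere gradients
(`NetFlux.cross_gradient_sub_radial`: the subtracted term is radial), obeys the curled law (`NetFlux.curledLawRadialGauge`, p683221-era), and is JOINTLY
real-analytic off the centre line (`Indicatrix.analyticOnNhd_radialGauge_uncurry`, the space-time radial gauge); K3^ω for `(v, T̃)` gives `∇T̃ × y = 0 = ∇T × y`.
★ `analyticFrame_of_analyticData : <K3^ω body verbatim> → CellFlux.AnalyticFrameTypeIScalarLiouville` closes the stub by name, and with the LANDED branches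
(`CellFlux.typeI_of_branches` p693177, Σ-5a `CellFlux.unthreadedGaugeRigidity` p720399, Σ-Z `CellFlux.zonalTypeIScalarLiouville`) ★★
`typeIScalarLiouville_of_analyticData : <K3^ω body> → CellFlux.TypeIScalarLiouville`: **the whole Type-I half of W1 follows BY NAME from Type-I scalar
Liouville for jointly analytic unthreaded data.**  HONEST LABEL: a reduction; K3^ω is OPEN (ns-qj-p1 g8's composition makes it conditional on
{`VandendriesMiller1994_realAnExp_isOMinimal`, Λ-1, Λ-2, Λ-0b+c, Σ-0bR₂}); ⟨1222⟩, W1 and NS regularity stay OPEN.  ARM A `pub/ns-exp-scalarLiouville` g8.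
-/

noncomputable section

-- the summit and its single sub-problem share the name (CONVENTIONS §1)
set_option linter.dupNamespace false

open Set Function Filter Topology InnerProductSpace MeasureTheory Metric
open scoped RealInnerProductSpace ContDiff

namespace Summit.NavierStokesRegularity.NavierStokesRegularity.Theorems.PoloidalLiouville.Indicatrix

open Summit.NavierStokesRegularity.NavierStokesRegularity.Theorems.PoloidalLiouville.NetFlux
  (E3 CurledLaw cross_gradient_sub_radial curledLawRadialGauge)
open Summit.NavierStokesRegularity.NavierStokesRegularity.Theorems.PoloidalLiouville.CellFlux
  (AnalyticFrameTypeIScalarLiouville TypeIScalarLiouville typeI_of_branches unthreadedGaugeRigidity zonalTypeIScalarLiouville)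
open Literature.Analysis Literature.Analysis.FluidPDE

/-- **The radial re-gauging does not change the sphere gradients**: for `x ≠ x₀`, `T` differentiable at `x` and at the ray point
`x₀ + ‖x − x₀‖ • σ₀`, `∇(T − T(x₀ + ‖· − x₀‖ • σ₀))(x) × (x − x₀) = ∇T(x) × (x − x₀)`. [folklore] -/
theorem cross_gradient_radialGauge {f : E3 → ℝ} {x₀ σ₀ x : E3} (hx : x ≠ x₀) (hf : DifferentiableAt ℝ f x)
    (hfr : DifferentiableAt ℝ f (x₀ + ‖x - x₀‖ • σ₀)) :
    cross (gradient (fun z => f z - f (x₀ + ‖z - x₀‖ • σ₀)) x) (x - x₀) = cross (gradient f x) (x - x₀) := by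
  set c : ℝ → ℝ := fun s => f (x₀ + Real.sqrt s • σ₀) with hc
  have hfun : (fun z => f z - f (x₀ + ‖z - x₀‖ • σ₀)) = fun z => f z - c (‖z - x₀‖ ^ 2) := by
    funext z
    simp only [hc, Real.sqrt_sq (norm_nonneg _)]
  rw [hfun]
  have hpos : ‖x - x₀‖ ^ 2 ≠ 0 := pow_ne_zero 2 (norm_ne_zero_iff.2 (sub_ne_zero.2 hx))
  have hcd : DifferentiableAt ℝ c (‖x - x₀‖ ^ 2) := by
    have h1 : DifferentiableAt ℝ (fun s : ℝ => x₀ + Real.sqrt s • σ₀) (‖x - x₀‖ ^ 2) :=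
      ((Real.hasDerivAt_sqrt hpos).differentiableAt.smul_const σ₀).const_add x₀
    have h2 : DifferentiableAt ℝ f (x₀ + Real.sqrt (‖x - x₀‖ ^ 2) • σ₀) := by
      rw [Real.sqrt_sq (norm_nonneg _)]; exact hfr
    exact DifferentiableAt.comp (‖x - x₀‖ ^ 2) (g := f) (f := fun s : ℝ => x₀ + Real.sqrt s • σ₀) h2 h1
  exact cross_gradient_sub_radial hf hcd

/-- ★ **Λ-5 BY NAME: `AnalyticDataTypeIScalarLiouville → AnalyticFrameTypeIScalarLiouville`** (hypothesis = the body of K3^ω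
`AnalyticDataTypeIScalarLiouville` of `Cruxes/PoloidalLiouville/IndicatrixSketch.lean` v1.7.5 §1 VERBATIM; conclusion = the landed Defs-twin Prop
`CellFlux.AnalyticFrameTypeIScalarLiouville`, `rfl`-pinned in the sketch).  The radial gauge with the base direction `σ₀ = e₀`. [folklore] -/
theorem analyticFrame_of_analyticData
    (hK : ∀ (v : ℝ → E3 → E3) (x₀ : E3) (T : ℝ → E3 → ℝ),
      (∃ C : ℝ, HasTypeITimeDecay C v) →
      IsBoundedAncientMildSolution 1 v →
      (∀ t < 0, AEStronglyMeasurable (v t) volume) →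
      ContDiffOn ℝ (⊤ : ℕ∞) (uncurry v) (Iio 0 ×ˢ univ) →
      ContDiffOn ℝ (⊤ : ℕ∞) (uncurry T) (Iio 0 ×ˢ ({x₀}ᶜ : Set E3)) →
      (∃ C : ℝ, ∀ t < 0, ∀ x, |T t x| ≤ C) →
      (∀ t < 0, ∀ x, curl (v t) x = cross (gradient (T t) x) (x - x₀)) →
      CurledLaw v x₀ T (Iio 0) →
      AnalyticOnNhd ℝ (uncurry v) (Iio 0 ×ˢ (univ : Set E3)) →
      AnalyticOnNhd ℝ (uncurry T) (Iio 0 ×ˢ ({x₀}ᶜ : Set E3)) →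
      ∀ t < 0, ∀ x, cross (gradient (T t) x) (x - x₀) = 0) :
    AnalyticFrameTypeIScalarLiouville := by
  intro v x₀ T hdec hmild hmeas hv hT hTb hlink hlaw hva
  set σ₀ : E3 := EuclideanSpace.single 0 1 with hσ₀def
  have hσ₀ : ‖σ₀‖ = 1 := by simp [hσ₀def]
  have hσ₀ne : σ₀ ≠ 0 := fun h => by rw [h, norm_zero] at hσ₀; exact zero_ne_one hσ₀
  set T' : ℝ → E3 → ℝ := fun t x => T t x - T t (x₀ + ‖x - x₀‖ • σ₀) with hT'
  -- the ray map `(t, x) ↦ (t, x₀ + ‖x − x₀‖ • σ₀)` is smooth off the centre line and stays off it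
  have hrayC : ContDiffOn ℝ (⊤ : ℕ∞) (fun p : ℝ × E3 => ((p.1, x₀ + ‖p.2 - x₀‖ • σ₀) : ℝ × E3))
      (Iio 0 ×ˢ ({x₀}ᶜ : Set E3)) := by
    intro p hp
    have hp2 : p.2 - x₀ ≠ 0 := sub_ne_zero.2 hp.2
    exact (contDiffAt_fst.prodMk (contDiffAt_const.add
      (((contDiffAt_snd.sub contDiffAt_const).norm ℝ hp2).smul contDiffAt_const))).contDiffWithinAt
  have hray_ne : ∀ x : E3, x ≠ x₀ → x₀ + ‖x - x₀‖ • σ₀ ≠ x₀ := by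
    intro x hx h
    rw [add_eq_left, smul_eq_zero] at h
    rcases h with h | h
    · exact hx (sub_eq_zero.1 (norm_eq_zero.1 h))
    · exact hσ₀ne h
  have hrayM : MapsTo (fun p : ℝ × E3 => ((p.1, x₀ + ‖p.2 - x₀‖ • σ₀) : ℝ × E3))
      (Iio 0 ×ˢ ({x₀}ᶜ : Set E3)) (Iio 0 ×ˢ ({x₀}ᶜ : Set E3)) :=
    fun p hp => ⟨hp.1, hray_ne p.2 hp.2⟩
  -- (5) smoothness of `T'`
  have hT's : ContDiffOn ℝ (⊤ : ℕ∞) (uncurry T') (Iio 0 ×ˢ ({x₀}ᶜ : Set E3)) := by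
    have h := hT.sub (hT.comp hrayC hrayM)
    refine h.congr fun p _ => ?_
    simp only [hT', uncurry, comp_apply]
  -- (6) boundedness
  obtain ⟨C, hC⟩ := hTb
  have hT'b : ∃ C' : ℝ, ∀ t < 0, ∀ x, |T' t x| ≤ C' := by
    refine ⟨C + C, fun t ht x => ?_⟩
    simp only [hT']
    exact (abs_sub _ _).trans (add_le_add (hC t ht x) (hC t ht _))
  -- slice differentiability of `T t` off the centre
  have hTd : ∀ t < 0, ∀ x : E3, x ≠ x₀ → DifferentiableAt ℝ (T t) x := by
    intro t ht x hx
    have h1 : ContDiffOn ℝ (⊤ : ℕ∞) (uncurry T ∘ fun z : E3 => (t, z)) ({x₀}ᶜ : Set E3) :=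
      hT.comp (contDiff_prodMk_right t).contDiffOn fun z hz => ⟨ht, hz⟩
    exact (h1.differentiableOn (by simp) x hx).differentiableAt (isOpen_compl_singleton.mem_nhds hx)
  -- (7) the link is gauge-invariant
  have hlink' : ∀ t < 0, ∀ x, curl (v t) x = cross (gradient (T' t) x) (x - x₀) := by
    intro t ht x
    by_cases hx : x = x₀
    · rw [hx, sub_self, NetFlux.cross_zero_right, hlink t ht, sub_self, NetFlux.cross_zero_right]
    · simp only [hT']
      rw [cross_gradient_radialGauge hx (hTd t ht x hx) (hTd t ht _ (hray_ne x hx)), hlink t ht]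
  -- (8) the curled law is gauge-covariant
  have hc : ContDiffOn ℝ (⊤ : ℕ∞) (uncurry fun t r => -T t (x₀ + r • σ₀)) (Iio 0 ×ˢ Ioi (0 : ℝ)) := by
    have h1 : ContDiffOn ℝ (⊤ : ℕ∞) (fun p : ℝ × ℝ => ((p.1, x₀ + p.2 • σ₀) : ℝ × E3)) (Iio 0 ×ˢ Ioi (0 : ℝ)) := by
      fun_prop
    have h2 : MapsTo (fun p : ℝ × ℝ => ((p.1, x₀ + p.2 • σ₀) : ℝ × E3)) (Iio 0 ×ˢ Ioi (0 : ℝ))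
        (Iio 0 ×ˢ ({x₀}ᶜ : Set E3)) := by
      intro p hp
      refine ⟨hp.1, ?_⟩
      show x₀ + p.2 • σ₀ ∈ ({x₀}ᶜ : Set E3)
      rw [mem_compl_singleton_iff, ne_eq, add_eq_left, smul_eq_zero, not_or]
      exact ⟨(ne_of_gt hp.2), hσ₀ne⟩
    have h := (hT.comp h1 h2).neg
    refine h.congr fun p _ => ?_
    simp only [uncurry, comp_apply]
  have hlaw' : CurledLaw v x₀ T' (Iio 0) := by
    have h := curledLawRadialGauge v x₀ T (fun t r => -T t (x₀ + r • σ₀)) (Iio 0) isOpen_Iio hv hT hc hlaw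
    have hfun : (fun t x => T t x + (fun t r => -T t (x₀ + r • σ₀)) t ‖x - x₀‖) = T' := by
      funext t x
      simp only [hT']
      ring
    rw [hfun] at h
    exact h
  -- (10) joint analyticity of `T'`
  have hT'a : AnalyticOnNhd ℝ (uncurry T') (Iio 0 ×ˢ ({x₀}ᶜ : Set E3)) :=
    analyticOnNhd_radialGauge_uncurry isOpen_Iio hσ₀ hva hT (fun t ht => hlink t ht)
  -- K3^ω for `(v, T')` and the transfer back to `T`
  have key := hK v x₀ T' hdec hmild hmeas hv hT's hT'b hlink' hlaw' hva hT'a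
  intro t ht x
  rw [← hlink t ht x, hlink' t ht x]
  exact key t ht x

/-- ★★ **K3^ω ⟹ the whole Type-I half of W1, BY NAME.**  With the landed branches — Σ-5a `CellFlux.unthreadedGaugeRigidity` (p720399: a Type-I unthreaded
flow is jointly analytic in its frame or zonal), Σ-Z `CellFlux.zonalTypeIScalarLiouville` (the zonal branch is irrotational), the glue `CellFlux.typeI_of_branches`
(p693177) — and Λ-5 above: Type-I scalar Liouville for JOINTLY ANALYTIC unthreaded data implies `CellFlux.TypeIScalarLiouville`.  (K3^ω itself is OPEN.)
[folklore] -/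
theorem typeIScalarLiouville_of_analyticData
    (hK : ∀ (v : ℝ → E3 → E3) (x₀ : E3) (T : ℝ → E3 → ℝ),
      (∃ C : ℝ, HasTypeITimeDecay C v) →
      IsBoundedAncientMildSolution 1 v →
      (∀ t < 0, AEStronglyMeasurable (v t) volume) →
      ContDiffOn ℝ (⊤ : ℕ∞) (uncurry v) (Iio 0 ×ˢ univ) →
      ContDiffOn ℝ (⊤ : ℕ∞) (uncurry T) (Iio 0 ×ˢ ({x₀}ᶜ : Set E3)) →
      (∃ C : ℝ, ∀ t < 0, ∀ x, |T t x| ≤ C) →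
      (∀ t < 0, ∀ x, curl (v t) x = cross (gradient (T t) x) (x - x₀)) →
      CurledLaw v x₀ T (Iio 0) →
      AnalyticOnNhd ℝ (uncurry v) (Iio 0 ×ˢ (univ : Set E3)) →
      AnalyticOnNhd ℝ (uncurry T) (Iio 0 ×ˢ ({x₀}ᶜ : Set E3)) →
      ∀ t < 0, ∀ x, cross (gradient (T t) x) (x - x₀) = 0) :
    TypeIScalarLiouville :=
  typeI_of_branches unthreadedGaugeRigidity zonalTypeIScalarLiouville (analyticFrame_of_analyticData hK)

end Summit.NavierStokesRegularity.NavierStokesRegularity.Theorems.PoloidalLiouville.Indicatrix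

end
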